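import Literature.NumberTheory.Automorphic.GaloisActionPlaces
import Mathlib.NumberTheory.NumberField.Basic
import Mathlib.RingTheory.Ideal.Norm.AbsNorm
import HarnessLib

/-!
# Route `SignedLowerHalves`, crux L `SmallImageLowerHalfBothSigns` (stmt-BirchSwinnertonDyer-23599), line `rtt_w3` — bookkeeping for the
# `c`-STABLE frame level of v7 (`stub_charRoadFrame_ns_of₇`: the export `cK • 𝔣 = 𝔣` = S4‴'s road input `h𝔣c`)

INPUTS hand `bsd-inputs-honda-p1` g32; helper `--supports stmt-BirchSwinnertonDyer-23599`; THEOREMS ONLY, no `sorry`; closes nothing; BSD / crux L /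
S4‴ are NOT proved by this. Pure ideal arithmetic in a quadratic field `K` with an automorphism `c` (`c² = 1`), acting on `𝓞 K`, its ideals
(Mathlib's pointwise `MulSemiringAction`) and its primes (`Literature.NumberTheory.Automorphic.instMulActionHeightOneSpectrum`):

* (`c * c = 1` for `[K:ℚ] = 2` is the tree's `RamifiedSevenEllipticUnits.QuadraticRamification.algEquiv_mul_self_eq_one_of_finrank_eq_two`);
* `smul_smul_eq`, `smul_le_asIdeal_iff` (`c • I ≤ 𝔭_w ↔ I ≤ 𝔭_{c•w}`), `smul_natCast'`, `eq_of_natCast_mem`, `smul_eq_self_of_natCast_mem` (the inert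
  prime `(p)` is the only prime above `p` and is `c`-fixed), `not_natCast_mem_of_le` (`p ∤ |d_K|·N𝔪` keeps the primes of `𝔪` away from `p`);
* ★ `forall_le_symmLevel` — if a property `R` of primes («`χ₀` is ramified at `w`») holds at the primes of `𝔣₀` and of `𝔪`, is `c`-symmetric away
  from `p`, and `supp 𝔪` is `c`-stable, then `R` holds at every prime of the SYMMETRISED level `𝔣₀ · (c • 𝔣₀) · (𝔪 · (c • 𝔪))` (frame (R));
* ★ `smul_symmLevel` — `c • (𝔣₀ · (c • 𝔣₀) · (𝔪 · (c • 𝔪)) · P) = …` the same, for a `c`-fixed `P` (here `P = (p)`): the v7 level IS `c`-stable.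

References: [Marcus2018] Ch. 2 (quadratic fields), Ch. 3 Thm. 23 (Galois action on the primes over `p`); [NeukirchANT1999] Ch. I §9.
-/

set_option autoImplicit false
-- the Theorems namespace of this sub repeats the summit name by design (D-0017 nested layout)
set_option linter.dupNamespace false

noncomputable section

open scoped NumberField Pointwise
open IsDedekindDomain NumberField Literature.NumberTheory.Automorphic

namespace Summit.BirchSwinnertonDyer.BirchSwinnertonDyer.Theorems.SmallImageRttD2FrameSymm

variable {K : Type} [Field K] [NumberField K]

/-- `c • (c • I) = I` for an involution `c`. [folklore] -/
theorem smul_smul_eq {c : K ≃ₐ[ℚ] K} (hc : c * c = 1) (I : Ideal (𝓞 K)) : c • (c • I) = I := by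
  rw [smul_smul, hc, one_smul]

/-- `c • w` twice is `w` for an involution `c`. [folklore] -/
theorem smul_smul_eq' {c : K ≃ₐ[ℚ] K} (hc : c * c = 1) (w : HeightOneSpectrum (𝓞 K)) : c • (c • w) = w := by
  rw [smul_smul, hc, one_smul]

/-- **`c • I ≤ 𝔭_w ↔ I ≤ 𝔭_{c • w}`** for an involution `c` (`c⁻¹ = c`). [folklore] -/
theorem smul_le_asIdeal_iff {c : K ≃ₐ[ℚ] K} (hc : c * c = 1) (I : Ideal (𝓞 K)) (w : HeightOneSpectrum (𝓞 K)) :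
    c • I ≤ w.asIdeal ↔ I ≤ (c • w).asIdeal := by
  rw [Ideal.pointwise_smul_subset_iff, HeightOneSpectrum.smul_asIdeal, inv_eq_of_mul_eq_one_right hc]

/-- `c` fixes the natural numbers of `𝓞 K`. [folklore] -/
theorem smul_natCast' (c : K ≃ₐ[ℚ] K) (n : ℕ) : c • ((n : ℕ) : 𝓞 K) = n :=
  map_natCast (MulSemiringAction.toRingHom (K ≃ₐ[ℚ] K) (𝓞 K) c) n

/-- `c • (n) = (n)` for a natural number `n`. [folklore] -/
theorem smul_span_natCast (c : K ≃ₐ[ℚ] K) (n : ℕ) : c • Ideal.span {((n : ℕ) : 𝓞 K)} = Ideal.span {((n : ℕ) : 𝓞 K)} := by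
  rw [Ideal.smul_closure, Set.smul_set_singleton, smul_natCast']

/-- **The inert prime is the only prime above `p`**: `p ∈ 𝔭_w` forces `w = v` when `𝔭_v = (p)`. [cite: Marcus2018, Ch. 3 Thm. 23] -/
theorem eq_of_natCast_mem {p : ℕ} {v w : HeightOneSpectrum (𝓞 K)} (hv : v.asIdeal = Ideal.span {((p : ℕ) : 𝓞 K)})
    (hw : ((p : ℕ) : 𝓞 K) ∈ w.asIdeal) : w = v :=
  HeightOneSpectrum.ext (v.isMaximal.eq_of_le w.isPrime.ne_top (by rw [hv, Ideal.span_singleton_le_iff_mem]; exact hw)).symm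

/-- **The inert prime is `c`-fixed**, in the form: every prime containing `p` is fixed by `c`. [cite: Marcus2018, Ch. 3 Thm. 23] -/
theorem smul_eq_self_of_natCast_mem {p : ℕ} {v w : HeightOneSpectrum (𝓞 K)} (c : K ≃ₐ[ℚ] K)
    (hv : v.asIdeal = Ideal.span {((p : ℕ) : 𝓞 K)}) (hw : ((p : ℕ) : 𝓞 K) ∈ w.asIdeal) : c • w = w := by
  have h2 : ((p : ℕ) : 𝓞 K) ∈ (c • w).asIdeal := by
    rw [HeightOneSpectrum.smul_asIdeal]
    have h := Ideal.smul_mem_pointwise_smul c _ w.asIdeal hw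
    rwa [smul_natCast'] at h
  exact (eq_of_natCast_mem hv h2).trans (eq_of_natCast_mem hv hw).symm

/-- **The primes of `𝔪` avoid `p`** when `p ∤ |d_K|·N𝔪` (`N𝔭_w ∣ N𝔪` and `p ∣ N𝔭_w` for `p ∈ 𝔭_w`). [folklore] -/
theorem not_natCast_mem_of_le {p : ℕ} (hp : p.Prime) {D : ℕ} {𝔪 : Ideal (𝓞 K)} (hcop : ¬ p ∣ D * Ideal.absNorm 𝔪)
    {w : HeightOneSpectrum (𝓞 K)} (hw : 𝔪 ≤ w.asIdeal) : ((p : ℕ) : 𝓞 K) ∉ w.asIdeal := by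
  intro hpw
  apply hcop
  have hNw : ((Ideal.absNorm w.asIdeal : ℕ) : 𝓞 K) ∈ w.asIdeal := Ideal.absNorm_mem w.asIdeal
  have hpN : p ∣ Ideal.absNorm w.asIdeal := by
    by_contra hnd
    obtain ⟨a, b, hab⟩ := Nat.Coprime.isCoprime ((Nat.Prime.coprime_iff_not_dvd hp).mpr hnd)
    have h1 : (1 : 𝓞 K) ∈ w.asIdeal := by
      have := congrArg (Int.cast : ℤ → 𝓞 K) hab
      push_cast at this
      rw [← this]
      exact w.asIdeal.add_mem (w.asIdeal.mul_mem_left _ hpw) (w.asIdeal.mul_mem_left _ hNw)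
    exact w.isPrime.ne_top ((Ideal.eq_top_iff_one _).mpr h1)
  exact hpN.trans ((Ideal.absNorm_dvd_absNorm_of_le hw).trans (dvd_mul_left _ _))

/-- ★ **Frame (R) for the symmetrised level.** Let `R` be a property of primes holding at the primes of `𝔣₀` and of `𝔪`, `c`-symmetric away from
`p` (`R (c • w) → R w` for `p ∉ 𝔭_w`), with the primes above `p` fixed by `c` and `supp 𝔪` `c`-stable. Then `R` holds at every prime of
`𝔣₀ · (c • 𝔣₀) · (𝔪 · (c • 𝔪))`. [folklore] -/
theorem forall_le_symmLevel {R : HeightOneSpectrum (𝓞 K) → Prop} {𝔣₀ 𝔪 : Ideal (𝓞 K)} {c : K ≃ₐ[ℚ] K} (hc : c * c = 1) {p : ℕ}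
    (hfix : ∀ w : HeightOneSpectrum (𝓞 K), ((p : ℕ) : 𝓞 K) ∈ w.asIdeal → c • w = w)
    (ha : ∀ w : HeightOneSpectrum (𝓞 K), 𝔣₀ ≤ w.asIdeal → R w)
    (hb : ∀ w : HeightOneSpectrum (𝓞 K), 𝔪 ≤ w.asIdeal → R w)
    (hsymm : ∀ w : HeightOneSpectrum (𝓞 K), ((p : ℕ) : 𝓞 K) ∉ w.asIdeal → R (c • w) → R w)
    (hd : ∀ w : HeightOneSpectrum (𝓞 K), 𝔪 ≤ (c • w).asIdeal → 𝔪 ≤ w.asIdeal) :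
    ∀ w : HeightOneSpectrum (𝓞 K), 𝔣₀ * (c • 𝔣₀) * (𝔪 * (c • 𝔪)) ≤ w.asIdeal → R w := by
  intro w hw
  rcases (Ideal.IsPrime.mul_le w.isPrime).mp hw with h1 | h2
  · rcases (Ideal.IsPrime.mul_le w.isPrime).mp h1 with h0 | hc0
    · exact ha w h0
    · -- `c • 𝔣₀ ≤ w`: `𝔣₀ ≤ c • w`, so `R (c • w)`
      have hR : R (c • w) := ha (c • w) ((smul_le_asIdeal_iff hc 𝔣₀ w).mp hc0)
      by_cases hpw : ((p : ℕ) : 𝓞 K) ∈ w.asIdeal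
      · rwa [hfix w hpw] at hR
      · exact hsymm w hpw hR
  · rcases (Ideal.IsPrime.mul_le w.isPrime).mp h2 with h𝔪 | hc𝔪
    · exact hb w h𝔪
    · exact hb w (hd w ((smul_le_asIdeal_iff hc 𝔪 w).mp hc𝔪))

/-- ★ **The symmetrised level is `c`-stable**: `c • (𝔣₀ · (c•𝔣₀) · (𝔪 · (c•𝔪)) · P^k) = 𝔣₀ · (c•𝔣₀) · (𝔪 · (c•𝔪)) · P^k` for a `c`-fixed `P`.
[folklore] -/
theorem smul_symmLevel {𝔣₀ 𝔪 P : Ideal (𝓞 K)} {c : K ≃ₐ[ℚ] K} (hc : c * c = 1) (hP : c • P = P) (k : ℕ) :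
    c • (𝔣₀ * (c • 𝔣₀) * (𝔪 * (c • 𝔪)) * P ^ k) = 𝔣₀ * (c • 𝔣₀) * (𝔪 * (c • 𝔪)) * P ^ k := by
  rw [smul_mul', smul_mul', smul_mul', smul_mul', smul_pow', hP, smul_smul_eq hc, smul_smul_eq hc, mul_comm (c • 𝔣₀) 𝔣₀,
    mul_comm (c • 𝔪) 𝔪]

/-- Divisibility bookkeeping for the symmetrised level: `𝔣₀ ∣ L`, `𝔪 ∣ L`, `P ∣ L` for `L = 𝔣₀ · (c•𝔣₀) · (𝔪 · (c•𝔪)) · P^1`. [folklore] -/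
theorem dvd_symmLevel (𝔣₀ 𝔪 P : Ideal (𝓞 K)) (c : K ≃ₐ[ℚ] K) :
    𝔣₀ ∣ 𝔣₀ * (c • 𝔣₀) * (𝔪 * (c • 𝔪)) * P ^ 1 ∧ 𝔪 ∣ 𝔣₀ * (c • 𝔣₀) * (𝔪 * (c • 𝔪)) * P ^ 1 ∧
      P ∣ 𝔣₀ * (c • 𝔣₀) * (𝔪 * (c • 𝔪)) * P ^ 1 := by
  refine ⟨?_, ?_, ?_⟩
  · exact ((dvd_mul_right 𝔣₀ (c • 𝔣₀)).trans (dvd_mul_right _ _)).trans (dvd_mul_right _ _)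
  · exact (((dvd_mul_right 𝔪 (c • 𝔪)).trans (dvd_mul_left _ _)).trans (dvd_mul_right _ _))
  · rw [pow_one]; exact dvd_mul_left _ _

end Summit.BirchSwinnertonDyer.BirchSwinnertonDyer.Theorems.SmallImageRttD2FrameSymm

end
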